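import Summits.Ventures.YMGap.RobustBall.ZNGaugePeeling
import Summits.Ventures.YMGap.RobustBall.ZNFluxLayer
import HarnessLib

/-!
# RobustBall/ZNFluxPeeling — Durhuus–Fröhlich peeling for `ℤ_N` lattice gauge theories with ARBITRARY
# inhomogeneous plaquette-flux weights: `‖⟨ψ(∮_{∂R×T} k)⟩_G‖ ≤ (4 c^T)^R` at `c = 2(d−1)A ≤ 1`, uniformly in `G`

HONEST FRAMING: venture file of the cell `pub-ymgap` (track Y2 ROBUST-BALL, seat ds-4 g8): finite sums on a finite
torus — a UNIFORM AREA-LAW BOUND FOR NON-WILSON `ℤ_N` LATTICE GAUGE ACTIONS `exp(∑_p G_p(flux_p))`, `|G_p| ≤ A`,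
at `c = 2(d−1)A ≤ 1`: `‖⟨ψ(∮_{∂R×T} k)⟩‖ ≤ (4 c^T)^R` for every non-wrapping `R × T` rectangle (`2R, 2T ≤ L`),
every `N ≥ 2` (`norm_cavg_ψ_loopSum_le`).  It is gen 7's `ZNGaugePeeling` (Wilson-type weights
`exp(β Re(ψ(flux_p) a_p))`) made a functor in the plaquette weight; the geometry (`ZN.bot/top/rung/transLine`,
`ZN.loopSum_glue`, block independence `FiniteGibbs.cavg_mul_eq_of_dependsOn`) is imported by name.  Mechanism
(Durhuus–Fröhlich 1980 / Mack–Petkova 1979 §2, pure plaquette action, no window): condition on the transverse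
links; the boundary sum splits into the transverse sides (a unimodular constant) and the `R` rungs; distinct
`i`-layers share no plaquette, so the layer weight factorises and the rung average is the PRODUCT of the `R`
single-rung averages, each of norm `≤ 4 c^T` (`ZNFlux.norm_cavg_ψ_sub_le`).  Consumer: the centre-tube area law
(`CentreProjectionFlux`, `CentreTubeAreaLaw`).  No `SU(N)` measure and nothing about the continuum limit here.
-/

noncomputable section

open Finset Function
open Literature.MathematicalPhysics.QuantumFieldTheory

namespace Summit.Ventures.YMGap.RobustBall

namespace ZNFlux

open ZN

variable {d L N : ℕ} [NeZero L] [NeZero N]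

/-! ### Independence of the `i`-layers -/

/-- An exponential of a sum of terms each reading only `B` reads only `B`. [folklore] -/
theorem dependsOn_exp_sum' {V : Type*} {S : Type*} {P : Type*} (s : Finset P) (φ : P → (V → S) → ℝ)
    (B : Set V) (h : ∀ p ∈ s, DependsOn (φ p) B) :
    DependsOn (fun σ : V → S => Real.exp (∑ p ∈ s, φ p σ)) B := fun σ τ hστ => by
  simp only
  rw [Finset.sum_congr rfl fun p hp => h p hp hστ]

/-- **The rung average factorises over the rungs** (layers at distinct `i`-heights share no plaquette; block
independence `FiniteGibbs.cavg_mul_eq_of_dependsOn`), for ANY flux weights `G`: for `n ≤ R`, `2R ≤ L`,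
`E ψ(rung_n) = ∏_{r<n} E ψ(kI(bot r) − kI(top r))`. [folklore] -/
theorem cavg_ψ_rung_eq_prod {i j : Fin d} (hij : i ≠ j) (kT : Transverse d L (ZMod N) i)
    (G : Plaquette d L → ZMod N → ℝ) (x : Site d L) (R T : ℕ) (hR : 2 * R ≤ L) :
    ∀ n : ℕ, n ≤ R → FiniteGibbs.cavg (layerWeightG i kT G) (fun kI => ψ N (rung x i j T n kI)) =
      ∏ r ∈ Finset.range n, FiniteGibbs.cavg (layerWeightG i kT G) (fun kI => ψ N (kI (bot x i r) - kI (top x i j T r)))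
  | 0, _ => by
      simp only [rung, Finset.sum_range_zero, Finset.prod_range_zero, ψ_zero]
      rw [FiniteGibbs.cavg]
      have hm : (FiniteGibbs.mass (layerWeightG i kT G) : ℂ) ≠ 0 := by
        rw [Ne, Complex.ofReal_eq_zero]
        exact (FiniteGibbs.mass_pos_of_pos (layerWeightG_pos i kT G)).ne'
      simp only [mul_one]
      rw [show (∑ σ : Site d L → ZMod N, (layerWeightG i kT G σ : ℂ)) = (FiniteGibbs.mass (layerWeightG i kT G) : ℂ)
        by rw [FiniteGibbs.mass]; push_cast; rfl, div_self hm]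
  | n + 1, hn => by
      classical
      have ih := cavg_ψ_rung_eq_prod hij kT G x R T hR n (Nat.le_of_succ_le hn)
      rw [Finset.prod_range_succ, ← ih]
      -- the layer of rung `n`
      set B : Finset (Site d L) := Finset.univ.filter fun y => y i = x i + ((n : ℕ) : ZMod L) with hB
      set u : (Site d L → ZMod N) → ℝ := fun kI =>
        Real.exp (∑ p ∈ Finset.univ.filter (fun p : Plaquette d L => p.1 i = x i + ((n : ℕ) : ZMod L)),
          phiG i kT G p kI) with hu
      set v : (Site d L → ZMod N) → ℝ := fun kI =>
        Real.exp (∑ p ∈ Finset.univ.filter (fun p : Plaquette d L => ¬p.1 i = x i + ((n : ℕ) : ZMod L)),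
          phiG i kT G p kI) with hv
      have hw : layerWeightG i kT G = fun kI => u kI * v kI := by
        funext kI
        rw [hu, hv]; dsimp only
        rw [← Real.exp_add, layerWeightG,
          ← Finset.sum_filter_add_sum_filter_not Finset.univ (fun p : Plaquette d L => p.1 i = x i + ((n : ℕ) : ZMod L))]
      have hBmem : ∀ y : Site d L, y ∈ (↑B : Set (Site d L)) ↔ y i = x i + ((n : ℕ) : ZMod L) := fun y => by
        rw [Finset.mem_coe, hB, Finset.mem_filter]; simp
      have hdepU : DependsOn u (↑B : Set (Site d L)) := by
        refine dependsOn_exp_sum' _ _ _ fun p hp => (dependsOn_phiG i kT G p).mono fun y hy => ?_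
        rw [hBmem, apply_eq_of_mem_iSites i p (Finset.mem_coe.1 hy)]
        exact (Finset.mem_filter.1 hp).2
      have hdepV : DependsOn v (↑B : Set (Site d L))ᶜ := by
        refine dependsOn_exp_sum' _ _ _ fun p hp => (dependsOn_phiG i kT G p).mono fun y hy => ?_
        rw [Set.mem_compl_iff, hBmem, apply_eq_of_mem_iSites i p (Finset.mem_coe.1 hy)]
        exact (Finset.mem_filter.1 hp).2
      -- the new rung reads layer `n`, the old rungs read the other layers
      have hbot : ∀ r : ℕ, bot x i r i = x i + ((r : ℕ) : ZMod L) := fun r => by simp [bot]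
      have htop : ∀ r : ℕ, top x i j T r i = x i + ((r : ℕ) : ZMod L) := fun r => by
        simp [top, Pi.single_eq_of_ne hij]
      have hF : DependsOn (fun kI : Site d L → ZMod N => ψ N (kI (bot x i n) - kI (top x i j T n))) (↑B : Set (Site d L)) :=
        fun kI kI' h => by
          simp only
          rw [h _ ((hBmem _).2 (hbot n)), h _ ((hBmem _).2 (htop n))]
      have hne : ∀ r ∈ Finset.range n, x i + ((r : ℕ) : ZMod L) ≠ x i + ((n : ℕ) : ZMod L) := by
        intro r hr h
        have hrn : r < n := Finset.mem_range.1 hr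
        have h' : ((r : ℕ) : ZMod L) = ((n : ℕ) : ZMod L) := add_left_cancel h
        rw [ZMod.natCast_eq_natCast_iff'] at h'
        rw [Nat.mod_eq_of_lt (by omega), Nat.mod_eq_of_lt (by omega)] at h'
        omega
      have hG : DependsOn (fun kI : Site d L → ZMod N => ψ N (rung x i j T n kI)) (↑B : Set (Site d L))ᶜ :=
        fun kI kI' h => by
          simp only [rung]
          rw [Finset.sum_congr rfl fun r hr => by
            rw [h _ (by rw [Set.mem_compl_iff, hBmem, hbot]; exact hne r hr),
              h _ (by rw [Set.mem_compl_iff, hBmem, htop]; exact hne r hr)]]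
      have hm : FiniteGibbs.mass (fun kI => u kI * v kI) ≠ 0 := by
        rw [← hw]; exact (FiniteGibbs.mass_pos_of_pos (layerWeightG_pos i kT G)).ne'
      have key := FiniteGibbs.cavg_mul_eq_of_dependsOn B hdepU hdepV hF hG hm
      rw [← hw] at key
      rw [mul_comm, ← key]
      refine congrArg _ (funext fun kI => ?_)
      rw [rung, Finset.sum_range_succ, ψ_add, mul_comm, ← rung]

/-! ### The uniform `ℤ_N` area-law bound -/

/-- **Uniform area-law bound, layer form** (any flux weights `|G| ≤ A`): given the transverse links,
`‖E ψ(rung_R)‖ ≤ (4 c^T)^R` (`N ≥ 2`, `c = 2(d−1)A ≤ 1`, `2R, 2T ≤ L`). [folklore] -/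
theorem norm_cavg_ψ_rung_le (hN : 2 ≤ N) {i j : Fin d} (hij : i ≠ j) (kT : Transverse d L (ZMod N) i)
    {G : Plaquette d L → ZMod N → ℝ} {A : ℝ} (hA0 : 0 ≤ A) (hA : ∀ p s, |G p s| ≤ A) {c : ℝ}
    (hc : 2 * ((d - 1 : ℕ) : ℝ) * A ≤ c) (hc1 : c ≤ 1) (x : Site d L) {R T : ℕ} (hR : 2 * R ≤ L)
    (hT : 2 * T ≤ L) :
    ‖FiniteGibbs.cavg (layerWeightG i kT G) (fun kI => ψ N (rung x i j T R kI))‖ ≤ (4 * c ^ T) ^ R := by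
  rw [cavg_ψ_rung_eq_prod hij kT G x R T hR R le_rfl, norm_prod, ← Finset.card_range R, ← Finset.prod_const,
    Finset.card_range]
  refine Finset.prod_le_prod (fun r _ => norm_nonneg _) fun r _ => ?_
  have h := norm_cavg_ψ_sub_le hN i j kT hA0 hA hc hc1 (bot x i r) (top x i j T r)
  rwa [show jDist j (top x i j T r) (bot x i r) = T from jDist_rung hij x r T hT] at h

/-- **The `ℤ_N` weight with ARBITRARY inhomogeneous flux weights** `G : Plaquette → ℤ/N → ℝ`:
`exp(∑_p G_p(flux_p(k)))`. [folklore] -/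
def znWG (G : Plaquette d L → ZMod N → ℝ) (k : Edge d L → ZMod N) : ℝ :=
  Real.exp (∑ p : Plaquette d L, G p (plaqSum k p.1 p.2.1.1 p.2.1.2))

omit [NeZero N] in
/-- The `ℤ_N` weight is positive. [folklore] -/
theorem znWG_pos (G : Plaquette d L → ZMod N → ℝ) (k : Edge d L → ZMod N) : 0 < znWG G k := Real.exp_pos _

omit [NeZero N] in
/-- On a glued configuration the `ℤ_N` weight is the layer weight. [folklore] -/
theorem znWG_glue (G : Plaquette d L → ZMod N → ℝ) (i : Fin d) (kI : Site d L → ZMod N)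
    (kT : Transverse d L (ZMod N) i) : znWG G (glue i kI kT) = layerWeightG i kT G kI := rfl

/-- **UNIFORM AREA-LAW BOUND FOR `ℤ_N` LATTICE GAUGE THEORIES WITH ARBITRARY PLAQUETTE-FLUX WEIGHTS**: for
`N ≥ 2`, any `G` with `|G p s| ≤ A`, `c = 2(d−1)A ≤ 1` and a non-wrapping `R × T` rectangle in the `(i, j)` plane,
`‖⟨ψ(∮_{∂R×T} k)⟩_G‖ ≤ (4 c^T)^R`. [cite: MackPetkova1979, §2] -/
theorem norm_cavg_ψ_loopSum_le (hN : 2 ≤ N) {i j : Fin d} (hij : i ≠ j) {G : Plaquette d L → ZMod N → ℝ}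
    {A : ℝ} (hA0 : 0 ≤ A) (hA : ∀ p s, |G p s| ≤ A) {c : ℝ} (hc : 2 * ((d - 1 : ℕ) : ℝ) * A ≤ c) (hc1 : c ≤ 1)
    (x : Site d L) {R T : ℕ} (hR : 2 * R ≤ L) (hT : 2 * T ≤ L) :
    ‖FiniteGibbs.cavg (znWG G) (fun k => ψ N (loopSum k x i j R T))‖ ≤ (4 * c ^ T) ^ R := by
  have hmass : 0 < FiniteGibbs.mass (znWG (N := N) (L := L) G) := FiniteGibbs.mass_pos_of_pos fun k => Real.exp_pos _
  rw [FiniteGibbs.cavg, norm_div, Complex.norm_real, Real.norm_eq_abs, abs_of_pos hmass, div_le_iff₀ hmass]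
  -- split numerator and mass into transverse and layer sums
  rw [sum_eq_sum_sum_glue i, FiniteGibbs.mass, sum_eq_sum_sum_glue i, Finset.mul_sum]
  refine (norm_sum_le _ _).trans (Finset.sum_le_sum fun kT _ => ?_)
  -- on the fibre of `kT` the transverse sides are a unimodular constant
  have hfac : ∑ kI : Site d L → ZMod N, (znWG G (glue i kI kT) : ℂ) * ψ N (loopSum (glue i kI kT) x i j R T) =
      ψ N (transLine j hij kT T (x + Pi.single i ((R : ℕ) : ZMod L)) - transLine j hij kT T x) *
        ∑ kI : Site d L → ZMod N, (layerWeightG i kT G kI : ℂ) * ψ N (rung x i j T R kI) := by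
    rw [Finset.mul_sum]
    refine Finset.sum_congr rfl fun kI _ => ?_
    rw [znWG_glue, loopSum_glue hij, ψ_add]; ring
  have hlayer : ∑ kI : Site d L → ZMod N, (layerWeightG i kT G kI : ℂ) * ψ N (rung x i j T R kI) =
      (FiniteGibbs.mass (layerWeightG i kT G) : ℂ) *
        FiniteGibbs.cavg (layerWeightG i kT G) (fun kI => ψ N (rung x i j T R kI)) := by
    rw [FiniteGibbs.cavg, mul_div_cancel₀]
    rw [Ne, Complex.ofReal_eq_zero]
    exact (FiniteGibbs.mass_pos_of_pos (layerWeightG_pos i kT G)).ne'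
  rw [hfac, hlayer, norm_mul, norm_ψ, one_mul, norm_mul, Complex.norm_real, Real.norm_eq_abs,
    abs_of_pos (FiniteGibbs.mass_pos_of_pos (layerWeightG_pos i kT G)), FiniteGibbs.mass]
  simp only [znWG_glue]
  rw [mul_comm]
  exact mul_le_mul_of_nonneg_right (norm_cavg_ψ_rung_le hN hij kT hA0 hA hc hc1 x hR hT)
    (Finset.sum_nonneg fun kI _ => (layerWeightG_pos i kT G kI).le)

/-! ### Consistency: the Wilson-type `ℤ_N` weight is the flux weight of `G_p(s) = β Re(ψ(s) a_p)` -/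

/-- Gen 7's Wilson-type `ℤ_N` weight `ZN.znW β a` is `znWG` of the flux weights `s ↦ β Re(ψ(s) a_p)`. [folklore] -/
theorem znW_eq_znWG (β : ℝ) (a : Plaquette d L → ℂ) :
    ZN.znW (N := N) β a = znWG fun p s => β * (ψ N s * a p).re := by
  funext k
  rw [ZN.znW, znWG, Finset.mul_sum]

end ZNFlux

end Summit.Ventures.YMGap.RobustBall

end
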